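import Mathlib
import Literature.GroupTheory.PermutationGroups.SmallIndexSubgroups
import Summits.ValiantsHypothesis.ValiantsHypothesis.Theorems.SymPencilSymmetrizePermPairsSmallIndexPairs
import HarnessLib

/-!
# ValiantsHypothesis / SymPencil — crux `SymmetrizePermPairs` (stmt-ValiantsHypothesis-17793),
# stub `stub_induce`, small-index regime, (C1) = (G5): a small-index subgroup of `𝔖_n × 𝔖_n`
# contains `Alt(Ω∖X₁) × Alt(Ω∖X₂)` (Dixon–Mortimer 5.2B for both projections + the Goursat dichotomy)

`prod_altFixing_le_of_small_index`: for `I ≤ Perm α × Perm α` with `8 < |α|`, `1 ≤ k`, `4k ≤ |α|`,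
`[Perm α × Perm α : I] < C(|α|, k)` and `2·[ : I] < (|α| − k)!` there are `X₁, X₂ ⊆ α` with
`|X_i| < k` and `Alt(α∖X₁) × Alt(α∖X₂) ≤ I`.  Proof: the projections have index `∣ [ : I]`
(`Subgroup.index_map_dvd`), so the tree's Dixon–Mortimer 5.2B
(`Literature.GroupTheory.PermutationGroups.alternating_fixing_le_of_index_lt_choose`) puts
`Alt(α∖X_i)` inside them; these are simple of order `(|α| − |X_i|)!/2 > [ : I]`
(`SmallIndex.isSimpleGroup_altFixing`, `two_mul_card_altFixing`), hence inside the Goursat fibres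
(`SmallIndex.le_goursatFst_of_index_lt_card` / `…Snd…`), and `N₁ × N₂ ≤ I`
(`Subgroup.goursatFst_prod_goursatSnd_le`).  This is the hypothesis (GS) of the assembly
`permEmbeddingD_sub_of_bounds` / `permify_subgroup_of_bounds` (at `α = Fin n`).  Cut of record:
merged-desk RULINGS #163 (b) / #167 / #181 ((G5) filed by p6).

Honest framing: helper layer for an OPEN stub of an OPEN crux; `VP ≠ VNP` is NOT proved and nothing
here is progress on it.  No new definitions, no named facts
(`--supports stmt-ValiantsHypothesis-17793 --as helper`).
-/

-- `Summit.ValiantsHypothesis.ValiantsHypothesis.…` is the tree's mandated single-conjunct layout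
-- (Sub = Summit), so the duplicated namespace component is intended.
set_option linter.dupNamespace false

namespace Summit.ValiantsHypothesis.ValiantsHypothesis.Theorems.SymPencilEquivariantSdcNotQP.SmallIndex

open Equiv Equiv.Perm

variable {α : Type*} [Fintype α] [DecidableEq α]

/-! ### Assembly with Dixon–Mortimer 5.2B for both projections -/

/-- **Small-index subgroups of `𝔖_n × 𝔖_n` contain `Alt(Ω∖X₁) × Alt(Ω∖X₂)`.**  Let
`I ≤ Perm α × Perm α` with `8 < |α|`, `1 ≤ k`, `4k ≤ |α|`, `[Perm α × Perm α : I] < C(|α|, k)` and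
`2 · [ : I] < (|α| − k)!`.  Then there are `X₁, X₂ ⊆ α` with `|X_i| < k` such that every pair
`(ρ₁, ρ₂)` of even permutations with `ρ_i` fixing `X_i` pointwise lies in `I`.  Proof: the
projections `K_i` have index `∣ [ : I]` (`Subgroup.index_map_dvd`), so Dixon–Mortimer 5.2B (tree,
`alternating_fixing_le_of_index_lt_choose`) gives `Alt(α∖X_i) ≤ K_i`; these are simple of order
`(|α| − |X_i|)!/2 > [ : I]`, hence lie in the Goursat fibres (`le_goursatFst_of_index_lt_card`), and
`N₁ × N₂ ≤ I` (`Subgroup.goursatFst_prod_goursatSnd_le`). [folklore] -/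
theorem prod_altFixing_le_of_small_index (I : Subgroup (Perm α × Perm α)) (k : ℕ)
    (hn : 8 < Fintype.card α) (hk : 1 ≤ k) (h4k : 4 * k ≤ Fintype.card α)
    (hidx : I.index < (Fintype.card α).choose k)
    (hidx2 : 2 * I.index < (Fintype.card α - k).factorial) :
    ∃ X₁ X₂ : Finset α, X₁.card < k ∧ X₂.card < k ∧
      ((alternatingGroup {x // x ∉ X₁}).map
          (Equiv.Perm.ofSubtype : Perm {x // x ∉ X₁} →* Perm α)).prod
        ((alternatingGroup {x // x ∉ X₂}).map
          (Equiv.Perm.ofSubtype : Perm {x // x ∉ X₂} →* Perm α)) ≤ I := by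
  have hIpos : 0 < I.index := Nat.pos_of_ne_zero Subgroup.index_ne_zero_of_finite
  -- the projections have small index
  have hK₁ : (I.map (MonoidHom.fst (Perm α) (Perm α))).index < (Fintype.card α).choose k :=
    lt_of_le_of_lt (Nat.le_of_dvd hIpos (I.index_map_dvd Prod.fst_surjective)) hidx
  have hK₂ : (I.map (MonoidHom.snd (Perm α) (Perm α))).index < (Fintype.card α).choose k :=
    lt_of_le_of_lt (Nat.le_of_dvd hIpos (I.index_map_dvd Prod.snd_surjective)) hidx
  -- Dixon–Mortimer 5.2B for both projections
  obtain ⟨X₁, hX₁, hA₁⟩ :=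
    Literature.GroupTheory.PermutationGroups.alternating_fixing_le_of_index_lt_choose
      (I.map (MonoidHom.fst (Perm α) (Perm α))) k hn hk h4k hK₁
  obtain ⟨X₂, hX₂, hA₂⟩ :=
    Literature.GroupTheory.PermutationGroups.alternating_fixing_le_of_index_lt_choose
      (I.map (MonoidHom.snd (Perm α) (Perm α))) k hn hk h4k hK₂
  refine ⟨X₁, X₂, hX₁, hX₂, ?_⟩
  -- numerics: `|α| − |X_i| ≥ |α| − k + 1 ≥ 5` and `(|α| − |X_i|)!/2 > [ : I]`
  have hbig : ∀ X : Finset α, X.card < k →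
      5 ≤ Fintype.card α - X.card ∧
        I.index < Nat.card ↥((alternatingGroup {x // x ∉ X}).map
          (Equiv.Perm.ofSubtype : Perm {x // x ∉ X} →* Perm α)) := by
    intro X hX
    have h5 : 5 ≤ Fintype.card α - X.card := by omega
    refine ⟨h5, ?_⟩
    have hc := two_mul_card_altFixing X (by omega)
    have hmono : (Fintype.card α - k).factorial ≤ (Fintype.card α - X.card).factorial :=
      Nat.factorial_le (by omega)
    omega
  have hle₁ : (alternatingGroup {x // x ∉ X₁}).map
      (Equiv.Perm.ofSubtype : Perm {x // x ∉ X₁} →* Perm α) ≤ I.goursatFst := by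
    obtain ⟨h5, hlt⟩ := hbig X₁ hX₁
    refine le_goursatFst_of_index_lt_card I _ (fun ρ hρ => ?_) (isSimpleGroup_altFixing X₁ h5) hlt
    obtain ⟨hfix, hsign⟩ := (mem_altFixing_iff X₁ ρ).mp hρ
    exact hA₁ ρ hfix hsign
  have hle₂ : (alternatingGroup {x // x ∉ X₂}).map
      (Equiv.Perm.ofSubtype : Perm {x // x ∉ X₂} →* Perm α) ≤ I.goursatSnd := by
    obtain ⟨h5, hlt⟩ := hbig X₂ hX₂
    refine le_goursatSnd_of_index_lt_card I _ (fun ρ hρ => ?_) (isSimpleGroup_altFixing X₂ h5) hlt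
    obtain ⟨hfix, hsign⟩ := (mem_altFixing_iff X₂ ρ).mp hρ
    exact hA₂ ρ hfix hsign
  exact (Subgroup.prod_mono hle₁ hle₂).trans I.goursatFst_prod_goursatSnd_le


end Summit.ValiantsHypothesis.ValiantsHypothesis.Theorems.SymPencilEquivariantSdcNotQP.SmallIndex
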